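import Summits.QuantumFields.YangMills.Theorems.UnitScaleTiltProp7TrueLinReality
import Literature.Analysis.Complex.RungeBoxes
import HarnessLib

/-!
# Crux stmt-QuantumFields-19936 `UnitScaleTilt.HistoryTailL`, K2 at depth (route crux `PoincareLipschitz.BlockLipschitzL`, stmt-QuantumFields-23533),
# card v1.26 (c) (R4) — THE NONLINEAR RE-GAUGE ABSORPTION LEMMA: a linearised pure gauge `P_Vξ = ξ(c₋) − V_c·ξ(c₊)·V_c*` is absorbed,
# to second order, by the honest gauge transformation `h = exp(−ξ)`:
# `‖Y(W^h) − (Y(W) − P_Vξ)‖ ≤ 8·t·(‖Y(W)‖ + t)` on every bond, `Y(W) = W·V* − 1 = pertVar V W`, whenever `‖ξ‖ ≤ t ≤ 1`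

Cell `ym3-torus` (YM ladder rung R3 = continuum SU(2) Yang–Mills on the three-torus — a RUNG, NOT the Clay problem: not d = 4, not infinite
volume, not a mass gap); width seat `ym-ust-19936-w2` g10 on LEAD `ym-ust-19936-w1` g7's word «(R4)-LOCATE … then the first missing letter as a
file» (2026-08-29T00:23:09Z); file F1 of the memo `R4-LOCATE-w2g10.md` (19936 evidence #46).  Helper `--supports stmt-QuantumFields-19936`;
THEOREMS ONLY (0 `def`, 0 `sorry`); nothing here proves `hStab`, a stub, `BlockLipschitzL`, `HistoryTailL` or a summit statement.

WHY (memo §2 (iii), §3).  The displayed row `hStab` of the K2-TOP door (✓`PoincareLipschitzIteratedOfAvgStability`, ✓p679967) asks for an HONEST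
level-`j` gauge transformation `h : GaugeTransf (F.P K) j SU(2)` with `dist1(Ū^j(U)_b·((Ū^jU')^h_b)⁻¹)` small.  The 19200 lane's true-linearisation
machinery produces, level by level, a LINEARISED pure gauge: the reduced split of the true one-step operator is
`T_V Z = LINE_V Z + P_{V̄}(CM_V Z) + Def` (✓`Prop7TrueLinReducedStep.norm_reduced_sub_line_le`), and along the tower `Q k Y = G_k + P_{Ū^{(k)}}Λ_k`
(✓`Prop7TrueLinIterStructure.trueLinIter_structure`), with the letter `P_Vξ(c) = ξ(c₋) − V_c·ξ(c₊)·V_c*` — the derivative at `s = 0` of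
`s ↦ pertVar V (gaugeAct (exp(s•ξ)) V)`.  This file is the one-bond algebra that turns «`Y − P_Vξ` is small» into «the ratio of the `exp(−ξ)`-RE-GAUGED
field is small», at the cost `8·t·(‖Y‖ + t)` — second order when `‖ξ‖ ≤ t` is of the order of the walk masses, which is the situation of the
per-level re-gauging (the absorbed `ξ = CM_j(Y′_j)` is ONE covariant comb mean of the current ratio, memo §2 (iii-c)); the values `exp(−ξ(y))` are honest
`SU(n)` elements as soon as `ξ` is `𝔰𝔲(n)`-valued (✓`Prop7TrueLinReality.exp_smul_mem_specialUnitaryGroup`, reality of the comb means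
✓`Prop7TrueLinReality.su_covCombMean`).

WHAT IS PROVED (ns `…Theorems.PoincareLipschitzRegaugeAbsorption`).
* §1 (any complete normed `ℂ`-algebra with `‖1‖ = 1`; the exponential remainder is the tree's ✓`Literature.Analysis.Complex.norm_exp_sub_one_sub_le`)
  `conj_ratio_sub_linear_eq` (the exact second-order expansion) and
  ★ `norm_conj_ratio_sub_linear_le`: `‖e^{−ξ₋}·W·e^{ξ₊}·V⁺ − 1 − ((W·V⁺ − 1) − (ξ₋ − V·ξ₊·V⁺))‖ ≤ 8·t·(‖W·V⁺ − 1‖ + t)` for `V·V⁺ = V⁺·V = 1`,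
  `‖V‖, ‖V⁺‖ ≤ 1`, `‖ξ±‖ ≤ t ≤ 1`.
* §2 (`SU(n)` gauge fields on any `Params`, any level `k`) `exists_gaugeTransf_coe_eq_exp_neg` (an `𝔰𝔲(n)`-valued site function exponentiates to a
  `GaugeTransf`), ★★ `norm_pertVar_gaugeAct_sub_le` (the title on every bond, for any `h` with `↑(h y) = exp(−ξ y)`),
  ★ `dist1_gaugeAct_mul_inv_le` / `dist1_mul_gaugeAct_inv_le` (the `dist1` readings in both orders, the second being `hStab`'s left side letter for letter:
  `dist1(V_c·((gaugeAct h W) c)⁻¹) ≤ ‖pertVar V W c − P_Vξ(c)‖ + 8t(‖pertVar V W c‖ + t)`).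
HONEST SCOPE.  Matrix algebra and the exponential series; no lattice analysis, no averaging; nothing of [Balaban1985Averaging] is asserted.

References: T. Bałaban, CMP 98 (1985) 17–51 [Balaban1985Averaging] ((8), (11) p.19; §3 (156)–(163) pp.44–46: fields re-expressed in the gauge of each
new block lattice); CMP 102 (1985) 277–309 [Balaban1985Variational] ((15) p.280).
-/

noncomputable section

open scoped BigOperators Matrix.Norms.L2Operator
open NormedSpace

namespace Summit.QuantumFields.YangMills.Theorems.PoincareLipschitzRegaugeAbsorption

open Literature.MathematicalPhysics.QuantumFieldTheory.Balaban1983to89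
open T4Continuum BlockAveragingEMLLinearisedBackground
open Literature.Analysis.Complex (norm_exp_sub_one_sub_le)
open Summit.QuantumFields.YangMills.Theorems.Prop7HolRatioPerStep (coe_star_mul_self coe_mul_star_self norm_coe_eq_one norm_star_coe_eq_one)
open Summit.QuantumFields.YangMills.Theorems.Prop7TrueLinReality (exp_smul_mem_specialUnitaryGroup)

/-! ## §1 The one-bond algebra in a complete normed algebra -/

section Algebra

variable {𝔄 : Type*} [NormedRing 𝔄] [NormedAlgebra ℂ 𝔄] [CompleteSpace 𝔄] [NormOneClass 𝔄]

omit [NormedAlgebra ℂ 𝔄] [CompleteSpace 𝔄] [NormOneClass 𝔄] in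
/-- **The exact second-order expansion.**  With `Y := W·V⁺ − 1`, `A := e^{−ξ₋} − 1 + ξ₋`, `B := e^{ξ₊} − 1 − ξ₊`, `Pξ := V·ξ₊·V⁺`, `C := V·B·V⁺`:
`e^{−ξ₋}·W·e^{ξ₊}·V⁺ − 1 − (Y − (ξ₋ − Pξ)) = C + Y·Pξ + Y·C − ξ₋·(Pξ + C + Y + Y·Pξ + Y·C) + A·(1 + Pξ + C + Y + Y·Pξ + Y·C)`
whenever `V·V⁺ = V⁺·V = 1`. [folklore] -/
theorem conj_ratio_sub_linear_eq {V Vs W ξm ξp : 𝔄} (hVVs : V * Vs = 1) (hVsV : Vs * V = 1) :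
    exp (-ξm) * W * exp ξp * Vs - 1 - ((W * Vs - 1) - (ξm - V * ξp * Vs)) =
      V * (exp ξp - 1 - ξp) * Vs + (W * Vs - 1) * (V * ξp * Vs) + (W * Vs - 1) * (V * (exp ξp - 1 - ξp) * Vs)
        - ξm * (V * ξp * Vs + V * (exp ξp - 1 - ξp) * Vs + (W * Vs - 1) + (W * Vs - 1) * (V * ξp * Vs)
            + (W * Vs - 1) * (V * (exp ξp - 1 - ξp) * Vs))
        + (exp (-ξm) - 1 + ξm) * (1 + V * ξp * Vs + V * (exp ξp - 1 - ξp) * Vs + (W * Vs - 1)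
            + (W * Vs - 1) * (V * ξp * Vs) + (W * Vs - 1) * (V * (exp ξp - 1 - ξp) * Vs)) := by
  -- `W = (W V⁺) V` and `V e^{ξ₊} V⁺ = 1 + V ξ₊ V⁺ + V B V⁺`
  have hW : W = (W * Vs) * V := by rw [mul_assoc, hVsV, mul_one]
  set E := exp ξp with hE
  set F := exp (-ξm) with hF
  have hconj : V * E * Vs = 1 + V * ξp * Vs + V * (E - 1 - ξp) * Vs := by
    have : V * (E - 1 - ξp) * Vs = V * E * Vs - V * Vs - V * ξp * Vs := by noncomm_ring
    rw [this, hVVs]; abel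
  have hlhs : F * W * E * Vs = F * ((W * Vs) * (V * E * Vs)) := by
    conv_lhs => rw [hW]
    noncomm_ring
  rw [hlhs, hconj]
  noncomm_ring

/-- **THE NONLINEAR RE-GAUGE ABSORPTION LEMMA (one bond).**  For `V·V⁺ = V⁺·V = 1`, `‖V‖ ≤ 1`, `‖V⁺‖ ≤ 1` and `‖ξ₋‖, ‖ξ₊‖ ≤ t ≤ 1`:
`‖e^{−ξ₋}·W·e^{ξ₊}·V⁺ − 1 − ((W·V⁺ − 1) − (ξ₋ − V·ξ₊·V⁺))‖ ≤ 8·t·(‖W·V⁺ − 1‖ + t)` — conjugating the ratio `Y = W·V⁺ − 1` by the gauge pair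
`(e^{−ξ₋}, e^{−ξ₊})` subtracts the linearised pure gauge `ξ₋ − V·ξ₊·V⁺` up to an error quadratic in `(‖Y‖, t)`. [folklore] -/
theorem norm_conj_ratio_sub_linear_le {V Vs W ξm ξp : 𝔄} {t : ℝ} (hVVs : V * Vs = 1) (hVsV : Vs * V = 1)
    (hV : ‖V‖ ≤ 1) (hVs : ‖Vs‖ ≤ 1) (hm : ‖ξm‖ ≤ t) (hp : ‖ξp‖ ≤ t) (ht : t ≤ 1) :
    ‖exp (-ξm) * W * exp ξp * Vs - 1 - ((W * Vs - 1) - (ξm - V * ξp * Vs))‖ ≤ 8 * t * (‖W * Vs - 1‖ + t) := by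
  have ht0 : 0 ≤ t := (norm_nonneg _).trans hm
  rw [conj_ratio_sub_linear_eq hVVs hVsV]
  -- the letters and their sizes
  set Y := W * Vs - 1 with hY
  set Pξ := V * ξp * Vs with hP
  set B := exp ξp - 1 - ξp with hB
  set C := V * B * Vs with hC
  set A := exp (-ξm) - 1 + ξm with hA
  have hPn : ‖Pξ‖ ≤ t :=
    calc ‖Pξ‖ ≤ ‖V‖ * ‖ξp‖ * ‖Vs‖ := (norm_mul_le _ _).trans (mul_le_mul_of_nonneg_right (norm_mul_le _ _) (norm_nonneg _))
      _ ≤ 1 * t * 1 := by gcongr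
      _ = t := by ring
  have hBn : ‖B‖ ≤ t ^ 2 :=
    (norm_exp_sub_one_sub_le (hp.trans ht)).trans (pow_le_pow_left₀ (norm_nonneg _) hp 2)
  have hCn : ‖C‖ ≤ t ^ 2 :=
    calc ‖C‖ ≤ ‖V‖ * ‖B‖ * ‖Vs‖ := (norm_mul_le _ _).trans (mul_le_mul_of_nonneg_right (norm_mul_le _ _) (norm_nonneg _))
      _ ≤ 1 * t ^ 2 * 1 := by gcongr
      _ = t ^ 2 := by ring
  have hAn : ‖A‖ ≤ t ^ 2 := by
    have h := norm_exp_sub_one_sub_le (x := -ξm) (by rw [norm_neg]; exact hm.trans ht)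
    rw [sub_neg_eq_add, norm_neg] at h
    exact h.trans (pow_le_pow_left₀ (norm_nonneg _) hm 2)
  set y := ‖Y‖ with hy
  have hy0 : 0 ≤ y := norm_nonneg _
  -- the inner sums
  have hYle : ‖Y‖ ≤ y := le_rfl
  have h1 : ‖Y * Pξ‖ ≤ y * t := (norm_mul_le _ _).trans (by gcongr)
  have h2 : ‖Y * C‖ ≤ y * t ^ 2 := (norm_mul_le _ _).trans (by gcongr)
  have hS : ‖Pξ + C + Y + Y * Pξ + Y * C‖ ≤ t + t ^ 2 + y + y * t + y * t ^ 2 :=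
    norm_add_le_of_le (norm_add_le_of_le (norm_add_le_of_le (norm_add_le_of_le hPn hCn) hYle) h1) h2
  have hS1 : ‖1 + Pξ + C + Y + Y * Pξ + Y * C‖ ≤ 1 + t + t ^ 2 + y + y * t + y * t ^ 2 :=
    norm_add_le_of_le (norm_add_le_of_le (norm_add_le_of_le (norm_add_le_of_le (norm_add_le_of_le norm_one.le hPn) hCn)
      hYle) h1) h2
  have hS0 : 0 ≤ t + t ^ 2 + y + y * t + y * t ^ 2 := by positivity
  have h3 : ‖ξm * (Pξ + C + Y + Y * Pξ + Y * C)‖ ≤ t * (t + t ^ 2 + y + y * t + y * t ^ 2) :=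
    (norm_mul_le _ _).trans (mul_le_mul hm hS (norm_nonneg _) ht0)
  have h4 : ‖A * (1 + Pξ + C + Y + Y * Pξ + Y * C)‖ ≤ t ^ 2 * (1 + t + t ^ 2 + y + y * t + y * t ^ 2) :=
    (norm_mul_le _ _).trans (mul_le_mul hAn hS1 (norm_nonneg _) (sq_nonneg _))
  have h5 : ‖C + Y * Pξ + Y * C - ξm * (Pξ + C + Y + Y * Pξ + Y * C) + A * (1 + Pξ + C + Y + Y * Pξ + Y * C)‖ ≤
      t ^ 2 + y * t + y * t ^ 2 + t * (t + t ^ 2 + y + y * t + y * t ^ 2)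
        + t ^ 2 * (1 + t + t ^ 2 + y + y * t + y * t ^ 2) :=
    norm_add_le_of_le (norm_sub_le_of_le (norm_add_le_of_le (norm_add_le_of_le hCn h1) h2) h3) h4
  refine h5.trans ?_
  -- the polynomial end-game, `0 ≤ t ≤ 1`, `0 ≤ y`
  have ht2 : t ^ 2 ≤ t := by nlinarith
  have ht3 : t ^ 3 ≤ t ^ 2 := by nlinarith
  have ht4 : t ^ 4 ≤ t ^ 2 := by nlinarith
  have hyt2 : y * t ^ 2 ≤ y * t := mul_le_mul_of_nonneg_left ht2 hy0
  have hyt3 : y * t ^ 3 ≤ y * t := mul_le_mul_of_nonneg_left (ht3.trans ht2) hy0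
  have hyt4 : y * t ^ 4 ≤ y * t := mul_le_mul_of_nonneg_left (ht4.trans ht2) hy0
  calc t ^ 2 + y * t + y * t ^ 2 + t * (t + t ^ 2 + y + y * t + y * t ^ 2)
        + t ^ 2 * (1 + t + t ^ 2 + y + y * t + y * t ^ 2)
      = 3 * t ^ 2 + 2 * t ^ 3 + t ^ 4 + 2 * (y * t) + 3 * (y * t ^ 2) + 2 * (y * t ^ 3) + y * t ^ 4 := by ring
    _ ≤ 8 * (y * t) + 8 * t ^ 2 := by linarith [sq_nonneg t]
    _ = 8 * t * (y + t) := by ring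

end Algebra

/-! ## §2 The reading on `SU(n)` gauge fields: `pertVar`, `gaugeAct`, `dist1` -/

section Fields

variable {n : Type*} [Fintype n] [DecidableEq n] [Nonempty n] {P : Params} {k : ℕ}

omit [Nonempty n] in
/-- An `𝔰𝔲(n)`-valued site function exponentiates to an honest gauge transformation: `∃ h : GaugeTransf P k SU(n)`, `↑(h y) = exp(−ξ y)`
(✓`Prop7TrueLinReality.exp_smul_mem_specialUnitaryGroup` at `t = −1`). [folklore] -/
theorem exists_gaugeTransf_coe_eq_exp_neg (ξ : Site P k → Matrix n n ℂ) (hξ : ∀ y, star (ξ y) = -ξ y ∧ (ξ y).trace = 0) :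
    ∃ h : GaugeTransf P k (Matrix.specialUnitaryGroup n ℂ), ∀ y, ((h y : Matrix.specialUnitaryGroup n ℂ) : Matrix n n ℂ) = exp (-ξ y) := by
  refine ⟨fun y => ⟨exp ((((-1 : ℝ)) : ℂ) • ξ y), exp_smul_mem_specialUnitaryGroup (hξ y) (-1)⟩, fun y => ?_⟩
  show exp ((((-1 : ℝ)) : ℂ) • ξ y) = exp (-ξ y)
  congr 1
  simp

omit [Nonempty n] in
/-- `‖exp(−X)‖`-free letter: for `↑h = exp(−ξ)` in `SU(n)`, `star ↑h = exp(ξ)` (`star exp(−ξ) = exp(−ξ)⁻¹ = exp ξ`). [folklore] -/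
theorem star_coe_eq_exp_of_coe_eq_exp_neg {h : Matrix.specialUnitaryGroup n ℂ} {ξ : Matrix n n ℂ}
    (hh : (h : Matrix n n ℂ) = exp (-ξ)) : star (h : Matrix n n ℂ) = exp ξ := by
  letI : NormedAlgebra ℚ (Matrix n n ℂ) := NormedAlgebra.restrictScalars ℚ ℂ _
  -- `star ↑h` is the two-sided inverse of `↑h = exp(−ξ)`, and so is `exp ξ`
  have h1 : star (h : Matrix n n ℂ) * exp (-ξ) = 1 := by rw [← hh]; exact coe_star_mul_self h
  have h2 : exp (-ξ) * exp ξ = (1 : Matrix n n ℂ) := by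
    rw [← exp_add_of_commute (Commute.refl ξ).neg_left, neg_add_cancel, exp_zero]
  calc star (h : Matrix n n ℂ) = star (h : Matrix n n ℂ) * (exp (-ξ) * exp ξ) := by rw [h2, mul_one]
    _ = exp ξ := by rw [← mul_assoc, h1, one_mul]

/-- **THE ABSORPTION LEMMA ON A BOND.**  `V, W` level-`k` `SU(n)` fields, `ξ` a site function with `‖ξ y‖ ≤ t ≤ 1`, `h` a gauge transformation with
`↑(h y) = exp(−ξ y)`.  Then on every bond `c`:
`‖pertVar V (gaugeAct h W) c − (pertVar V W c − (ξ c₋ − V_c·ξ c₊·V_c*))‖ ≤ 8·t·(‖pertVar V W c‖ + t)`. [folklore] -/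
theorem norm_pertVar_gaugeAct_sub_le (V W : GaugeField P k (Matrix.specialUnitaryGroup n ℂ)) (ξ : Site P k → Matrix n n ℂ)
    (h : GaugeTransf P k (Matrix.specialUnitaryGroup n ℂ)) (hh : ∀ y, ((h y : Matrix.specialUnitaryGroup n ℂ) : Matrix n n ℂ) = exp (-ξ y))
    {t : ℝ} (hξ : ∀ y, ‖ξ y‖ ≤ t) (ht : t ≤ 1) (c : PBond P k) :
    ‖pertVar V (GaugeField.gaugeAct h W) c -
        (pertVar V W c - (ξ c.src - ((V c : Matrix.specialUnitaryGroup n ℂ) : Matrix n n ℂ) * ξ c.tgt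
          * star ((V c : Matrix.specialUnitaryGroup n ℂ) : Matrix n n ℂ)))‖ ≤ 8 * t * (‖pertVar V W c‖ + t) := by
  have hlhs : pertVar V (GaugeField.gaugeAct h W) c =
      exp (-ξ c.src) * ((W c : Matrix.specialUnitaryGroup n ℂ) : Matrix n n ℂ) * exp (ξ c.tgt)
        * star ((V c : Matrix.specialUnitaryGroup n ℂ) : Matrix n n ℂ) - 1 := by
    rw [pertVar_eq]
    unfold GaugeField.gaugeAct
    rw [Submonoid.coe_mul, Submonoid.coe_mul,
      show (((h c.tgt)⁻¹ : Matrix.specialUnitaryGroup n ℂ) : Matrix n n ℂ) = star ((h c.tgt : Matrix.specialUnitaryGroup n ℂ) : Matrix n n ℂ)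
        from rfl, hh c.src, star_coe_eq_exp_of_coe_eq_exp_neg (hh c.tgt)]
  rw [hlhs, pertVar_eq]
  exact norm_conj_ratio_sub_linear_le (coe_mul_star_self (V c)) (coe_star_mul_self (V c)) (norm_coe_eq_one (V c)).le
    (norm_star_coe_eq_one (V c)).le (hξ c.src) (hξ c.tgt) ht

/-- `dist1(W_c·V_c⁻¹) = ‖pertVar V W c‖` (the `SU(n)` model's `dist1 g = ‖g − 1‖`, ✓`FederbushMean.dist1_SU_eq`). [folklore] -/
theorem dist1_mul_inv_eq_norm_pertVar (V W : GaugeField P k (Matrix.specialUnitaryGroup n ℂ)) (c : PBond P k) :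
    dist1 (W c * (V c)⁻¹) = ‖pertVar V W c‖ := by
  rw [FederbushMean.dist1_SU_eq]
  rfl

/-- **`dist1` READING, ratio order**: `dist1((gaugeAct h W) c · V_c⁻¹) ≤ ‖pertVar V W c − P_Vξ(c)‖ + 8t(‖pertVar V W c‖ + t)`. [folklore] -/
theorem dist1_gaugeAct_mul_inv_le (V W : GaugeField P k (Matrix.specialUnitaryGroup n ℂ)) (ξ : Site P k → Matrix n n ℂ)
    (h : GaugeTransf P k (Matrix.specialUnitaryGroup n ℂ)) (hh : ∀ y, ((h y : Matrix.specialUnitaryGroup n ℂ) : Matrix n n ℂ) = exp (-ξ y))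
    {t : ℝ} (hξ : ∀ y, ‖ξ y‖ ≤ t) (ht : t ≤ 1) (c : PBond P k) :
    dist1 (GaugeField.gaugeAct h W c * (V c)⁻¹) ≤
      ‖pertVar V W c - (ξ c.src - ((V c : Matrix.specialUnitaryGroup n ℂ) : Matrix n n ℂ) * ξ c.tgt
          * star ((V c : Matrix.specialUnitaryGroup n ℂ) : Matrix n n ℂ))‖ + 8 * t * (‖pertVar V W c‖ + t) := by
  rw [dist1_mul_inv_eq_norm_pertVar]
  have hb := norm_pertVar_gaugeAct_sub_le V W ξ h hh hξ ht c
  have key := norm_le_insert' (pertVar V (GaugeField.gaugeAct h W) c)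
    (pertVar V W c - (ξ c.src - ((V c : Matrix.specialUnitaryGroup n ℂ) : Matrix n n ℂ) * ξ c.tgt
          * star ((V c : Matrix.specialUnitaryGroup n ℂ) : Matrix n n ℂ)))
  linarith

/-- **`dist1` READING, `hStab`'s order**: `dist1(V_c · ((gaugeAct h W) c)⁻¹) ≤ ‖pertVar V W c − P_Vξ(c)‖ + 8t(‖pertVar V W c‖ + t)`
(`dist1(g⁻¹) = dist1 g`, `(a·b⁻¹)⁻¹ = b·a⁻¹`) — the left side of the displayed row of ✓`PoincareLipschitzIteratedOfAvgStability` with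
`V := Ū^j(U)`, `W := Ū^j(U')`. [folklore] -/
theorem dist1_mul_gaugeAct_inv_le (V W : GaugeField P k (Matrix.specialUnitaryGroup n ℂ)) (ξ : Site P k → Matrix n n ℂ)
    (h : GaugeTransf P k (Matrix.specialUnitaryGroup n ℂ)) (hh : ∀ y, ((h y : Matrix.specialUnitaryGroup n ℂ) : Matrix n n ℂ) = exp (-ξ y))
    {t : ℝ} (hξ : ∀ y, ‖ξ y‖ ≤ t) (ht : t ≤ 1) (c : PBond P k) :
    dist1 (V c * (GaugeField.gaugeAct h W c)⁻¹) ≤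
      ‖pertVar V W c - (ξ c.src - ((V c : Matrix.specialUnitaryGroup n ℂ) : Matrix n n ℂ) * ξ c.tgt
          * star ((V c : Matrix.specialUnitaryGroup n ℂ) : Matrix n n ℂ))‖ + 8 * t * (‖pertVar V W c‖ + t) := by
  have hinv : V c * (GaugeField.gaugeAct h W c)⁻¹ = (GaugeField.gaugeAct h W c * (V c)⁻¹)⁻¹ := by
    rw [mul_inv_rev, inv_inv]
  rw [hinv, GaugeGroup.dist1_inv]
  exact dist1_gaugeAct_mul_inv_le V W ξ h hh hξ ht c

end Fields

end Summit.QuantumFields.YangMills.Theorems.PoincareLipschitzRegaugeAbsorption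

end
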